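import Summits.Ventures.HodgeRepro.Tier3EigenBasis
import Summits.Ventures.HodgeRepro.Tier3WedgeBaseChange

/-!
# LEMMA-R-RESIDUE.md §5 as ONE kernel statement: eigenbasis → coordinate wedges → rational class of an orbit

Blind re-derivation cell `pub-hodge-repro`, seat `t3-p4` (Tier 3, T3.5 for T3.4).  Target tree path
`lean/Summits/Ventures/HodgeRepro/Tier3WedgeChain.lean`; imports the cell's `Tier3EigenBasis` and
`Tier3WedgeBaseChange` (hence `Tier3OrbitRational`, `Tier3SubspaceDescent`, `Tier3OrbitDescent`, `Tier3GaloisDescent`).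

WHAT THIS FILE STATES.  The kernel chain behind LEMMA-R-RESIDUE.md §5 (v8 §10) is spread over four tree modules:
`Tier3EigenBasis` (the Galois-equivariant eigenbasis `e (j, x)` of `H¹ ⊗ F`), `Tier3WedgeBaseChange` (its coordinate
wedges, a basis of `H^{2p} ⊗ F = (∧^{2p} H¹) ⊗ F` equivariant up to sign) and `Tier3SubspaceDescent` +
`Tier3OrbitRational` (a non-zero rational vector of a Galois-stable span of wedge lines with every orbit coefficient
non-zero).  `exists_eigenbasis_wedge_chain` composes them into one theorem whose hypotheses are exactly the data of
§5: a finite Galois extension `K/F₀` (`F = K`, `ℚ = F₀`), a `K`-vector space `V` with a `K`-basis `ω : J → V`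
(`H¹(B_red, ℚ)` with its `F`-generators `ω_j`), the degree `n = 2p`, and an action of `Gal(K/F₀)` on the index set
`J × Gal(K/F₀)` by left multiplication on the second factor (the model of `Hom(F^J, ℂ) = J × S`); its conclusion
packages the eigenbasis `e`, a base-change isomorphism `Φ`, the wedge basis `E` with `Φ (E_s) = e_{s₁} ∧ ⋯ ∧ e_{sₙ}`,
its equivariance up to `ε(σ, s) ∈ {1, −1}`, and §5 (i′)–(iv′): for every `F₀`-subspace `W ≤ ⋀[F₀]^n V` and every
Galois-stable set `P` of `n`-subsets whose wedges lie in `W ⊗ K` (the Pohlmann lines of the reduced sets, printed: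
M1 p0003:L68–L82 — the only input left on paper), every `s₀ ∈ P` yields a non-zero `η ∈ W` whose coefficient on every
wedge of the orbit of `s₀` is non-zero (night-1's `e · m^* η ≠ 0` then follows coefficient by coefficient).

Beside it, `exists_perm_sign_rTensor_wedge` makes the sign explicit: `(σ ⊗ 1) E_s = sign(π) • E_{σ • s}` for the
permutation `π` of `Fin n` with `enum (σ • s) ∘ π = σ • enum s` — `ε(τ, U)` IS the sign of the permutation `τ` induces
on the ordered set `U`, as the v7 §5 CORRECTION states.

HONESTY.  Linear algebra on Mathlib over the cell's own Tier-3 modules; nothing here is about Hodge classes beyond the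
abstract statement.  HC_CM is NOT proved by anyone in this repository.
-/

set_option autoImplicit false

open TensorProduct

namespace HodgeRepro.Tier3

variable {F₀ K : Type*} [Field F₀] [Field K] [Algebra F₀ K]
variable {V : Type*} [AddCommGroup V] [Module F₀ V]
/-- **The sign made explicit.**  For the wedge basis `E_s := Φ⁻¹ (e_{s₁} ∧ ⋯ ∧ e_{sₙ})` of an equivariant basis `e`,
`(σ ⊗ 1) E_s = sign(π) • E_{σ • s}` where `π` is the permutation of `Fin n` with `enum (σ • s) ∘ π = σ • enum s`
(`exists_perm_smul_enum`) — `ε(τ, U)` of LEMMA-R-RESIDUE.md v7 §5 CORRECTION is the sign of the permutation `τ`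
induces on the ordered set `U`. -/
theorem exists_perm_sign_rTensor_wedge {ι : Type*} [LinearOrder ι] [MulAction (K ≃ₐ[F₀] K) ι] (n : ℕ)
    (Φ : K ⊗[F₀] ⋀[F₀]^n V ≃ₗ[K] ⋀[K]^n (K ⊗[F₀] V))
    (hΦ : ∀ (k : K) (v : Fin n → V),
      Φ (k ⊗ₜ[F₀] exteriorPower.ιMulti F₀ n v) =
        k • exteriorPower.ιMulti K n (fun i => (1 : K) ⊗ₜ[F₀] v i))
    (e : Module.Basis ι K (K ⊗[F₀] V))
    (hequiv : ∀ (σ : K ≃ₐ[F₀] K) (i : ι), LinearMap.rTensor V σ.toLinearMap (e i) = e (σ • i))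
    (σ : K ≃ₐ[F₀] K) (s : Set.powersetCard ι n) :
    ∃ π : Equiv.Perm (Fin n),
      (∀ j : Fin n, Set.powersetCard.ofFinEmbEquiv.symm (σ • s) (π j) =
        σ • Set.powersetCard.ofFinEmbEquiv.symm s j) ∧
      LinearMap.rTensor (⋀[F₀]^n V) σ.toLinearMap ((e.exteriorPower n).map Φ.symm s) =
        ((Equiv.Perm.sign π : ℤ) : K) • (e.exteriorPower n).map Φ.symm (σ • s) := by
  classical
  obtain ⟨π, hπ⟩ := exists_perm_smul_enum n σ s
  refine ⟨π, hπ, ?_⟩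
  apply Φ.injective
  rw [LinearEquiv.map_smul, Module.Basis.map_apply, Module.Basis.map_apply, LinearEquiv.apply_symm_apply,
    exteriorPower.basis_apply, exteriorPower.basis_apply, exteriorPower.ιMulti_family,
    exteriorPower.ιMulti_family, wedgeBaseChange_rTensor_symm_ιMulti n Φ hΦ σ]
  have h1 : LinearMap.rTensor V σ.toLinearMap ∘ (e ∘ Set.powersetCard.ofFinEmbEquiv.symm s) =
      (e ∘ Set.powersetCard.ofFinEmbEquiv.symm (σ • s)) ∘ π := by
    funext j
    simp only [Function.comp_apply, hequiv, hπ]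
  rw [h1, AlternatingMap.map_perm, Units.smul_def, ← Int.cast_smul_eq_zsmul K]

variable [Module K V] [IsScalarTower F₀ K V]
variable {J : Type*} [Fintype J]
variable [FiniteDimensional F₀ K] [IsGalois F₀ K]

/-- **LEMMA-R-RESIDUE.md §5 as one kernel statement.**  For a finite Galois extension `K/F₀`, a `K`-space `V` with a
`K`-basis `ω : J → V`, a degree `n`, a linear order on `J × Gal(K/F₀)` and an action of `Gal(K/F₀)` on it by left
multiplication on the second factor, there are: the Galois-equivariant eigenbasis `e` of `K ⊗[F₀] V`
(`Tier3EigenBasis`: `(σ ⊗ 1) e (j, x) = e (j, σ x)`, `(1 ⊗ b) e (j, x) = x(b) • e (j, x)`), a base-change isomorphism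
`Φ : K ⊗[F₀] ⋀[F₀]^n V ≃ ⋀[K]^n (K ⊗[F₀] V)`, and the wedge basis `E` of `K ⊗[F₀] ⋀[F₀]^n V` with
`Φ (E_s) = e_{s₁} ∧ ⋯ ∧ e_{sₙ}`, `(σ ⊗ 1) E_s = ε(σ, s) • E_{σ • s}` with `ε(σ, s) ∈ {1, −1}`, such that for every
subspace `W ≤ ⋀[F₀]^n V` and every Galois-stable set `P` of `n`-subsets whose wedges lie in `W ⊗ K`, each `s₀ ∈ P`
yields a NON-ZERO rational `η ∈ W` in the span of the orbit's wedges with a non-zero coefficient on every wedge of the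
orbit of `s₀`. -/
theorem exists_eigenbasis_wedge_chain (n : ℕ) (ω : Module.Basis J K V)
    [LinearOrder (J × (K ≃ₐ[F₀] K))] [MulAction (K ≃ₐ[F₀] K) (J × (K ≃ₐ[F₀] K))]
    (hact : ∀ (σ x : K ≃ₐ[F₀] K) (j : J), σ • (j, x) = (j, σ * x)) :
    ∃ (e : Module.Basis (J × (K ≃ₐ[F₀] K)) K (K ⊗[F₀] V))
      (E : Module.Basis (Set.powersetCard (J × (K ≃ₐ[F₀] K)) n) K (K ⊗[F₀] ⋀[F₀]^n V))
      (Φ : K ⊗[F₀] ⋀[F₀]^n V ≃ₗ[K] ⋀[K]^n (K ⊗[F₀] V)),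
      (∀ (σ x : K ≃ₐ[F₀] K) (j : J), LinearMap.rTensor V σ.toLinearMap (e (j, x)) = e (j, σ * x)) ∧
      (∀ (x : K ≃ₐ[F₀] K) (j : J) (b : K),
        LinearMap.lTensor K ((LinearMap.lsmul K V b).restrictScalars F₀) (e (j, x)) = x b • e (j, x)) ∧
      (∀ (k : K) (v : Fin n → V),
        Φ (k ⊗ₜ[F₀] exteriorPower.ιMulti F₀ n v) =
          k • exteriorPower.ιMulti K n (fun i => (1 : K) ⊗ₜ[F₀] v i)) ∧
      (∀ s, Φ (E s) = exteriorPower.ιMulti_family K n e s) ∧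
      (∃ u : (K ≃ₐ[F₀] K) → Set.powersetCard (J × (K ≃ₐ[F₀] K)) n → K,
        (∀ σ s, u σ s = 1 ∨ u σ s = -1) ∧
        ∀ (σ : K ≃ₐ[F₀] K) s, LinearMap.rTensor (⋀[F₀]^n V) σ.toLinearMap (E s) = u σ s • E (σ • s)) ∧
      ∀ (W : Submodule F₀ (⋀[F₀]^n V)) (P : Set (Set.powersetCard (J × (K ≃ₐ[F₀] K)) n)),
        (∀ (σ : K ≃ₐ[F₀] K), ∀ s ∈ P, σ • s ∈ P) → (∀ s ∈ P, E s ∈ W.baseChange K) →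
        ∀ s₀ ∈ P, ∃ η : ⋀[F₀]^n V, η ∈ W ∧ η ≠ 0 ∧
          (1 : K) ⊗ₜ[F₀] η ∈ Submodule.span K (E '' MulAction.orbit (K ≃ₐ[F₀] K) s₀) ∧
          ∀ s ∈ MulAction.orbit (K ≃ₐ[F₀] K) s₀, E.repr ((1 : K) ⊗ₜ[F₀] η) s ≠ 0 := by
  classical
  obtain ⟨e, he1, he2⟩ := exists_equivariant_eigenbasis (F₀ := F₀) ω
  have hequiv : ∀ (σ : K ≃ₐ[F₀] K) (i : J × (K ≃ₐ[F₀] K)),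
      LinearMap.rTensor V σ.toLinearMap (e i) = e (σ • i) := by
    rintro σ ⟨j, x⟩
    rw [hact, he1]
  obtain ⟨Φ, hΦ⟩ := exists_wedgeBaseChange (F₀ := F₀) (K := K) (V := V) n
  obtain ⟨u, hu, hE⟩ := exists_wedge_basis_equiv n Φ hΦ e hequiv
  refine ⟨e, (e.exteriorPower n).map Φ.symm, Φ, he1, he2, hΦ, fun s => ?_, ⟨u, hu, hE⟩, ?_⟩
  · rw [Module.Basis.map_apply, LinearEquiv.apply_symm_apply, exteriorPower.basis_apply]
  · intro W P hP hPW s₀ hs₀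
    exact exists_rational_wedge_of_orbit n e hequiv Φ hΦ W P hP hPW s₀ hs₀

end HodgeRepro.Tier3
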